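import Summits.QuantumFields.YangMills.Theses.MirrorModularBoosts

/-!
# `HypercubicLimit` (crux stmt-QuantumFields-8646, route MirrorModularBoosts) — negative side:
# the crux is NECESSARY for the summit and for its own weak-coupling re-type

Refuter crux-attack record (2026-08-17).  The only live copy of the β-free existence leg is
`Summit.QuantumFields.YangMills.Theses.MirrorModularBoosts.HypercubicLimit` (routes
CoincidenceRotationBootstrap / PencilRigidity re-typed theirs to the weak-coupling form on 2026-08-16,
and `MirrorModularBoosts.closes` rev 16 consumes `WeakCouplingHypercubicLimit`, not this decl).

* `not_yangMills_of_not_hypercubicLimit` — **`¬ HypercubicLimit → ¬ YangMills`**: a summit witness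
  `(r, sch, T)` is a crux witness verbatim (`S := T.schwinger`; forget the rotation half of E1 and the
  clause `sch.HasWeakCouplingLimit`; proper-hypercubic invariance is the `det = 1` half of E1 restricted).
  Consequence for the adversary: no unconditional `¬` of this crux exists short of a disproof of the
  Clay statement in the tree's rendering; every junk handle (trivial `G`, `β ≡ 0`, `c ≡ 0`, values of
  `S` off `⁰𝒮`) is already closed by the landed `Negative/*` lemmas of this directory.
* `not_weakCouplingHypercubicLimit_of_not_hypercubicLimit` — the re-type is MONOTONE: the sibling crux
  `WeakCouplingHypercubicLimit` (stmt-QuantumFields-16154, the conjunct `closes` consumes) implies this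
  one by dropping its first conjunct, so a kill here kills 16154 and breaks the route all the same.
[folklore]
-/

open Literature.MathematicalPhysics.QuantumLattice Literature.MathematicalPhysics.AQFT
  Literature.MathematicalPhysics.QuantumFieldTheory

namespace Summit.QuantumFields.YangMills.Theorems.HypercubicLimit.Negative

/-- **Any kill of `MirrorModularBoosts.HypercubicLimit` refutes `YangMills` as typed** (the summit
implies the crux: forget `SO(4)` and the weak-coupling clause). [folklore] -/
theorem not_yangMills_of_not_hypercubicLimit
    (h : ¬ Summit.QuantumFields.YangMills.Theses.MirrorModularBoosts.HypercubicLimit) :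
    ¬ YangMills := by
  intro hYM
  refine h fun G _ _ _ _ hG => ?_
  letI : MeasurableSpace G := borel G
  haveI : BorelSpace G := ⟨rfl⟩
  obtain ⟨r, sch, T, _hweak, hYMfor, hnt, hng, Δ, hΔ, hgap, hlat⟩ := hYM G hG
  exact ⟨r, sch, T.schwinger, ⟨T.normalized, T.hermitian, T.linearGrowth, T.reflectionPositive,
    T.symmetric, T.cluster, T.invariant.1, fun n k R hdet _ F hF => T.invariant.2 n k R hdet F hF⟩,
    hYMfor, hnt, hng, Δ, hΔ, hgap, hlat⟩

/-- **Any kill of `MirrorModularBoosts.HypercubicLimit` kills the weak-coupling re-type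
`MirrorModularBoosts.WeakCouplingHypercubicLimit`** (stmt-QuantumFields-16154): drop the conjunct
`sch.HasWeakCouplingLimit`. [folklore] -/
theorem not_weakCouplingHypercubicLimit_of_not_hypercubicLimit
    (h : ¬ Summit.QuantumFields.YangMills.Theses.MirrorModularBoosts.HypercubicLimit) :
    ¬ Summit.QuantumFields.YangMills.Theses.MirrorModularBoosts.WeakCouplingHypercubicLimit := by
  intro hW
  refine h fun G _ _ _ _ hG => ?_
  letI : MeasurableSpace G := borel G
  haveI : BorelSpace G := ⟨rfl⟩
  obtain ⟨r, sch, S, _hweak, hrest⟩ := hW G hG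
  exact ⟨r, sch, S, hrest⟩

end Summit.QuantumFields.YangMills.Theorems.HypercubicLimit.Negative
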